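import Literature.AlgebraicGeometry.Resolution.StrictTransformOpenImmersion
import Literature.AlgebraicGeometry.Resolution.MarkedIdealsLemmas
import Mathlib.RingTheory.FiniteType
import Mathlib.RingTheory.Localization.Away.Basic
import HarnessLib

/-!
# Birational flattening, I: the chart lemma

Topic: `Literature/AlgebraicGeometry/Resolution`. First half of an elementary proof of the
special case of Raynaud–Gruson flattening (Stacks, Tag 081R; the named fact `Stacks081R`,
`StrictTransformFlattening.lean`) in which `X → S` is an ISOMORPHISM over the quasi-compact
open `U ⊆ S` — the only case entering Stacks, Tag 081S (`StrictTransformOpenImmersion.lean`: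
"a morphism which is an isomorphism over `U` becomes an open immersion after a `U`-admissible
blowing up") and hence the only case needed for Nagata's compactification theorem (Stacks,
Tag 0F41 = Conrad 2007, Thm. 4.1; the named fact `Morphisms.NagataCompactification`).

**The chart lemma** (`isOpenImmersion_blowupStrictTransformMap_of_relations`). Let `ζ : Z → S`
be a morphism of affine schemes, locally of finite type, which is an isomorphism over `D(u)`,
`u ∈ Γ(S, 𝒪_S)`, and such that `ζ⁻¹D(u)` is schematically dense in `Z`. Then `Γ(Z, 𝒪_Z)` is
generated over `Γ(S, 𝒪_S)` by finitely many sections `x` with `u^N x = g_x`, `g_x ∈ Γ(S, 𝒪_S)`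
(`exists_finset_generators_relations`: over `D(u)`, `x` is a fraction `g/uⁿ`). Put
`J = (u^N, g_x)`. For every `b : T → S` such that `b⁻¹L 𝒪_T` (`V(L) = V(u)`) and `b⁻¹J 𝒪_T`
are effective Cartier divisors — e.g. any blowing up of `S` dominating the blowing up in
`J · L` — the strict transform `Z' → T` of `Z` along `b` (Stacks, Tag 080D;
`blowupStrictTransformMap`) is an OPEN IMMERSION. This is the algebra of the affine blow-up
chart `Spec A[J/u^N] = Spec A[g_x/u^N] = Z` (Stacks, Tag 0804; Conrad 2007, proof of Thm. 2.4,
Case 1), organised around the universal property of blowing ups rather than around charts: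

* `exists_affineOpen_sections` — every point of `Z'` lies over an affine open `W ⊆ T` on
  which `b♯(g_x) = c_x · b♯(u)^N` for all `x` (where `b⁻¹J 𝒪_T|_W = (τ)`, `τ` regular,
  `b♯u^N = v₀τ`, `b♯g_x = v_xτ` and `1 = w₀v₀ + Σ w_xv_x`; if `v_x` does not vanish at the
  point then the relation `u^N x = g_x`, read on `Z'` where `b♯u` is regular — a unit on the
  dense open over `b⁻¹D(u)` — forces `v₀` not to vanish there either);
* `exists_ringHom_section`, `exists_hom_over_of_ringHom`, `exists_lift_strictTransform` — over
  such a `W` the assignment `x ↦ c_x` is a ring map `Γ(Z, 𝒪_Z) → Γ(T, W)` over `Γ(S, 𝒪_S)`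
  (it is the transfer through `ζ⁻¹D(u) ≅ D(u)` followed by restriction to the dense
  `W ∩ b⁻¹D(u)`, which lands in `Γ(T, W) ⊆ Γ(T, W ∩ b⁻¹D(u))`), i.e. a morphism `W → Z` over
  `S`, whose graph `W → Z ×_S T` factors through the closed subscheme `Z'` (it kills the ideal
  of the closure of the part over `b⁻¹D(u)`, `W ∩ b⁻¹D(u)` being schematically dense in `W`);
* `isIso_morphismRestrict_blowupStrictTransformMap_of_sections` — this section is inverse to
  `Z'|_W → W` (compare the two composites inside `Z ×_S T`: over `T` trivially, over the
  affine `Z` through global sections, on the generators `x` using once more that `b♯u` is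
  regular on `Z'`);
* `isOpenImmersion_blowupStrictTransformMap_of_relations` — **the chart lemma**, by
  Zariski-locality of open immersions on the union of the good opens `W`.

Generic lemmas proved on the way: sections over a quasi-compact schematically dense open
(`map_injective_of_isSchemeTheoreticallyDominant`, `mem_nonZeroDivisors_of_inf_le_basicOpen`),
`isIso_app_of_isIso_morphismRestrict(_of_le)`, `exists_hom_appTop_eq` (morphisms to an affine
scheme with prescribed `appTop`), `isIso_of_isIso_appTop`, `ker_ι_le_ker` (a morphism with
schematically dense preimage of `O` kills the ideal of the closure of `O`).

## References

* The Stacks Project, Tags 081R, 081S, 080D, 0804, 0F41. [StacksProject]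
* B. Conrad, *Deligne's notes on Nagata compactifications*, J. Ramanujan Math. Soc. 22 (2007),
  proof of Thm. 2.4 (Case 1) and Thm. 2.11. [Conrad2007]
-/

noncomputable section

set_option backward.isDefEq.respectTransparency false

open CategoryTheory CategoryTheory.Limits AlgebraicGeometry TopologicalSpace

namespace Literature.AlgebraicGeometry.Resolution

universe u

/-! ## Generic lemmas -/

section Generic

variable {X : Scheme.{u}}

/-- For a quasi-compact, scheme-theoretically dominant open `O ⊆ X`, restriction of sections
from an open `W` to `W ∩ O` is injective. [folklore] -/
theorem map_injective_of_isSchemeTheoreticallyDominant (O : X.Opens) [QuasiCompact O.ι]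
    [IsSchemeTheoreticallyDominant O.ι] (W : X.Opens) :
    Function.Injective (X.presheaf.map (homOfLE (inf_le_left : W ⊓ O ≤ W)).op) := by
  have h := O.ι.app_injective W
  have e : O.ι ''ᵁ O.ι ⁻¹ᵁ W = W ⊓ O := by
    rw [Scheme.Hom.image_preimage_eq_opensRange_inf, Scheme.Opens.opensRange_ι, inf_comm]
  intro s t hst
  apply h
  rw [Scheme.Opens.ι_app]
  have key : ∀ r : Γ(X, W), X.presheaf.map (homOfLE (x := O.ι ''ᵁ O.ι ⁻¹ᵁ W) (y := W)
      (Set.image_preimage_subset _ _)).op r =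
      X.presheaf.map (eqToHom e).op (X.presheaf.map (homOfLE (inf_le_left : W ⊓ O ≤ W)).op r) := by
    intro r
    rw [← CommRingCat.comp_apply, ← Functor.map_comp]
    rfl
  change X.presheaf.map (homOfLE (x := O.ι ''ᵁ O.ι ⁻¹ᵁ W) (y := W) (Set.image_preimage_subset _ _)).op s =
    X.presheaf.map (homOfLE (x := O.ι ''ᵁ O.ι ⁻¹ᵁ W) (y := W) (Set.image_preimage_subset _ _)).op t
  rw [key, key, hst]

/-- A section over `W` which becomes a unit on `W ∩ O`, `O` a quasi-compact scheme-theoretically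
dense open, is a non-zero-divisor of `Γ(X, W)`. [folklore] -/
theorem mem_nonZeroDivisors_of_isUnit_res (O : X.Opens) [QuasiCompact O.ι]
    [IsSchemeTheoreticallyDominant O.ι] (W : X.Opens) (s : Γ(X, W))
    (hs : IsUnit (X.presheaf.map (homOfLE (inf_le_left : W ⊓ O ≤ W)).op s)) :
    s ∈ nonZeroDivisors Γ(X, W) := by
  rw [mem_nonZeroDivisors_iff_right]
  intro x hx
  apply map_injective_of_isSchemeTheoreticallyDominant O W
  rw [map_zero]
  have := congrArg (X.presheaf.map (homOfLE (inf_le_left : W ⊓ O ≤ W)).op) hx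
  rw [map_mul, map_zero] at this
  exact (hs.mul_left_eq_zero).mp this

/-- A section which is a unit on an open containing `W ∩ O` … variant: if `W ⊓ O ≤ X.basicOpen s`
then `s` is regular. [folklore] -/
theorem mem_nonZeroDivisors_of_inf_le_basicOpen (O : X.Opens) [QuasiCompact O.ι]
    [IsSchemeTheoreticallyDominant O.ι] (W : X.Opens) (s : Γ(X, W))
    (hs : W ⊓ O ≤ X.basicOpen s) : s ∈ nonZeroDivisors Γ(X, W) := by
  refine mem_nonZeroDivisors_of_isUnit_res O W s ?_
  have hD : X.basicOpen (X.presheaf.map (homOfLE (inf_le_left : W ⊓ O ≤ W)).op s) = W ⊓ O := by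
    rw [Scheme.basicOpen_res]
    exact inf_eq_left.mpr hs
  refine RingedSpace.isUnit_of_isUnit_germ (X := X.toRingedSpace) _ _ fun x hx => ?_
  exact (X.mem_basicOpen _ x hx).mp (hD.symm ▸ hx)


/-- Two generators of the same principal ideal, one of them regular: the other is regular too,
and they differ by a unit. [folklore] -/
theorem Ideal.mem_nonZeroDivisors_of_span_singleton_eq {R : Type*} [CommRing R] {a t : R}
    (ht : t ∈ nonZeroDivisors R) (h : Ideal.span {a} = Ideal.span {t}) :
    a ∈ nonZeroDivisors R ∧ ∃ v : Rˣ, a = v * t := by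
  have ha : a ∈ Ideal.span {t} := h ▸ Ideal.mem_span_singleton_self a
  have ht' : t ∈ Ideal.span {a} := h.symm ▸ Ideal.mem_span_singleton_self t
  obtain ⟨v, rfl⟩ := Ideal.mem_span_singleton'.mp ha
  obtain ⟨w, hw⟩ := Ideal.mem_span_singleton'.mp ht'
  -- `t = w v t`, so `w v = 1`
  have hwv : w * v = 1 := by
    have h1 : (w * v - 1) * t = 0 := by rw [sub_mul, one_mul, mul_assoc, hw, sub_self]
    exact sub_eq_zero.mp ((mem_nonZeroDivisors_iff_right.mp ht) _ h1)
  have hvu : IsUnit v := IsUnit.of_mul_eq_one_right w hwv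
  refine ⟨?_, hvu.unit, by simp⟩
  exact mul_mem (hvu.mem_nonZeroDivisors) ht

/-- The basic open of a finite sum is contained in the union of the basic opens. [folklore] -/
theorem basicOpen_finset_sum_le {U : X.Opens} {ι : Type*} (s : Finset ι) (f : ι → Γ(X, U)) :
    X.basicOpen (∑ i ∈ s, f i) ≤ ⨆ i ∈ s, X.basicOpen (f i) := by
  classical
  induction s using Finset.induction_on with
  | empty => simp
  | insert a s has ih =>
    rw [Finset.sum_insert has]
    refine (X.basicOpen_add_le _ _).trans (sup_le ?_ (ih.trans ?_))
    · exact le_iSup₂_of_le a (Finset.mem_insert_self a s) le_rfl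
    · exact iSup₂_le fun i hi => le_iSup₂_of_le i (Finset.mem_insert_of_mem hi) le_rfl

/-- If `∑ i ∈ s, w i * v i = 1` on `U` then every point of `U` lies in some `D(v i)`. [folklore] -/
theorem exists_mem_basicOpen_of_sum_mul_eq_one {U : X.Opens} {ι : Type*} (s : Finset ι)
    (w v : ι → Γ(X, U)) (h : ∑ i ∈ s, w i * v i = 1) {x : X} (hx : x ∈ U) :
    ∃ i ∈ s, x ∈ X.basicOpen (v i) := by
  have hx' : x ∈ X.basicOpen (∑ i ∈ s, w i * v i) := by rw [h, Scheme.basicOpen_one]; exact hx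
  have := basicOpen_finset_sum_le s _ hx'
  obtain ⟨i, hi⟩ := Opens.mem_iSup.mp this
  obtain ⟨his, hxi⟩ := Opens.mem_iSup.mp hi
  rw [Scheme.basicOpen_mul] at hxi
  exact ⟨i, his, hxi.2⟩

/-- Restriction of a quasi-compact scheme-theoretically dense open to an open subscheme (along an
open immersion) is scheme-theoretically dense. [folklore] -/
theorem isSchemeTheoreticallyDominant_ι_preimage {T T₀ : Scheme.{u}} (j : T₀ ⟶ T)
    [IsOpenImmersion j] (O : T.Opens) [QuasiCompact O.ι] [IsSchemeTheoreticallyDominant O.ι] :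
    IsSchemeTheoreticallyDominant (j ⁻¹ᵁ O).ι :=
  ⟨by
    have h := ker_ι_preimage_eq_comap j O (j ⁻¹ᵁ O) rfl
    rw [h, IsSchemeTheoreticallyDominant.ker_eq_bot (f := O.ι), Scheme.IdealSheafData.comap_bot]⟩

/-- The preimage of a quasi-compact open along an open immersion has quasi-compact inclusion.
[folklore] -/
theorem quasiCompact_ι_preimage {T T₀ : Scheme.{u}} (j : T₀ ⟶ T) [IsOpenImmersion j]
    (O : T.Opens) [QuasiCompact O.ι] : QuasiCompact (j ⁻¹ᵁ O).ι :=
  MorphismProperty.of_isPullback (isPullback_morphismRestrict j O) inferInstance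

/-- **A morphism to `Y` whose preimage of a quasi-compact open `O ⊆ Y` is scheme-theoretically
dense kills the ideal of the scheme-theoretic closure of `O`.** [folklore] -/
theorem ker_ι_le_ker {P Y : Scheme.{u}} (g : P ⟶ Y) (O : Y.Opens) [QuasiCompact O.ι]
    [QuasiCompact (g ⁻¹ᵁ O).ι] [IsSchemeTheoreticallyDominant (g ⁻¹ᵁ O).ι] :
    O.ι.ker ≤ g.ker := by
  -- `ker O.ι ≤ ker g` iff `(ker O.ι).comap g = ⊥`
  rw [← Scheme.IdealSheafData.map_bot g, Scheme.IdealSheafData.le_map_iff_comap_le,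
    ← IsSchemeTheoreticallyDominant.ker_eq_bot (f := (g ⁻¹ᵁ O).ι)]
  -- and `(ker O.ι).comap g ≤ ker (g⁻¹O).ι`: `g⁻¹O ↪ P` factors through `P ×_Y closure(O) → P`
  have hcomm : (g ⁻¹ᵁ O).ι ≫ g = ((g ∣_ O) ≫ O.ι.toImage) ≫ O.ι.imageι := by
    rw [Category.assoc, Scheme.Hom.toImage_imageι, morphismRestrict_ι]
  have hfac : pullback.lift (g ⁻¹ᵁ O).ι ((g ∣_ O) ≫ O.ι.toImage) hcomm ≫
      pullback.fst g O.ι.ker.subschemeι = (g ⁻¹ᵁ O).ι := pullback.lift_fst _ _ _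
  calc O.ι.ker.comap g = (pullback.fst g O.ι.ker.subschemeι).ker := rfl
    _ ≤ (pullback.lift (g ⁻¹ᵁ O).ι ((g ∣_ O) ≫ O.ι.toImage) hcomm ≫
        pullback.fst g O.ι.ker.subschemeι).ker := Scheme.Hom.le_ker_comp _ _
    _ = (g ⁻¹ᵁ O).ι.ker := by rw [hfac]

/-- Restriction of sections from `W` to an open `V` with `W ∩ O ⊆ V ⊆ W` is injective, for `O` a
quasi-compact scheme-theoretically dense open. [folklore] -/
theorem map_injective_of_isSchemeTheoreticallyDominant_of_le (O : X.Opens) [QuasiCompact O.ι]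
    [IsSchemeTheoreticallyDominant O.ι] {V W : X.Opens} (hVW : V ≤ W) (hV : W ⊓ O ≤ V) :
    Function.Injective (X.presheaf.map (homOfLE hVW).op) := by
  intro s t hst
  apply map_injective_of_isSchemeTheoreticallyDominant O W
  have : X.presheaf.map (homOfLE (inf_le_left : W ⊓ O ≤ W)).op =
      X.presheaf.map (homOfLE hVW).op ≫ X.presheaf.map (homOfLE hV).op := by
    rw [← Functor.map_comp]; rfl
  rw [this, CommRingCat.comp_apply, CommRingCat.comp_apply, hst]

/-- If `f|_U` is an isomorphism then `f♯ : Γ(Y, U) → Γ(X, f⁻¹U)` is an isomorphism. [folklore] -/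
theorem isIso_app_of_isIso_morphismRestrict {X Y : Scheme.{u}} (f : X ⟶ Y) (U : Y.Opens)
    [IsIso (f ∣_ U)] : IsIso (f.app U) := by
  have h : IsIso (f.app (U.ι ''ᵁ ⊤)) := by
    have h2 := morphismRestrict_appTop f U
    haveI : IsIso (f.app (U.ι ''ᵁ ⊤) ≫
        X.presheaf.map (eqToHom (image_morphismRestrict_preimage f U ⊤)).op) := by
      rw [← h2]; infer_instance
    exact IsIso.of_isIso_comp_right (f.app (U.ι ''ᵁ ⊤))
      (X.presheaf.map (eqToHom (image_morphismRestrict_preimage f U ⊤)).op)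
  rwa [Scheme.Opens.ι_image_top] at h

/-- A ring map `θ : B → R'` whose values lie in the range of an injective ring map `ι : R → R'`
factors through `ι`. [folklore] -/
theorem RingHom.exists_comp_eq_of_forall_mem_range {B R R' : Type*} [CommRing B] [CommRing R]
    [CommRing R'] (θ : B →+* R') (ι : R →+* R') (hι : Function.Injective ι)
    (h : ∀ x, θ x ∈ Set.range ι) : ∃ χ : B →+* R, ι.comp χ = θ := by
  choose c hc using h
  let χ : B →+* R :=
    { toFun := c
      map_one' := hι (by rw [hc, map_one, map_one])
      map_mul' := fun x y => hι (by rw [hc, map_mul, map_mul, hc, hc])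
      map_zero' := hι (by rw [hc, map_zero, map_zero])
      map_add' := fun x y => hι (by rw [hc, map_add, map_add, hc, hc]) }
  exact ⟨χ, RingHom.ext fun x => hc x⟩

/-- **Morphisms to an affine scheme with prescribed map on global sections**: for `Z` affine,
every `χ : Γ(Z, 𝒪_Z) → Γ(X, 𝒪_X)` is `w♯` for a (unique, `ext_of_isAffine`) morphism `w : X → Z`.
[folklore] -/
theorem exists_hom_appTop_eq {X Z : Scheme.{u}} [IsAffine Z] (χ : Γ(Z, ⊤) ⟶ Γ(X, ⊤)) :
    ∃ w : X ⟶ Z, w.appTop = χ := by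
  refine ⟨X.toSpecΓ ≫ Spec.map χ ≫ Z.isoSpec.inv, ?_⟩
  have h1 : (Spec.map χ).appTop = (Scheme.ΓSpecIso Γ(Z, ⊤)).hom ≫ χ ≫
      (Scheme.ΓSpecIso Γ(X, ⊤)).inv := by
    rw [Scheme.ΓSpecIso_inv_naturality, Iso.hom_inv_id_assoc]
  have h2 : Z.isoSpec.inv.appTop = (Scheme.ΓSpecIso Γ(Z, ⊤)).inv := by
    have h3 : Z.isoSpec.hom.appTop = (Scheme.ΓSpecIso Γ(Z, ⊤)).hom := by
      rw [Scheme.isoSpec, asIso_hom, Scheme.toSpecΓ_appTop]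
    have h4 : Z.isoSpec.inv.appTop ≫ Z.isoSpec.hom.appTop = 𝟙 _ := by
      rw [← Scheme.Hom.comp_appTop, Iso.hom_inv_id, Scheme.Hom.id_appTop]
    rw [h3] at h4
    rw [← Category.comp_id Z.isoSpec.inv.appTop, ← (Scheme.ΓSpecIso Γ(Z, ⊤)).hom_inv_id,
      ← Category.assoc, h4, Category.id_comp]
  rw [Scheme.Hom.comp_appTop, Scheme.Hom.comp_appTop, Scheme.toSpecΓ_appTop, h1, h2]
  simp only [Category.assoc, Iso.inv_hom_id, Category.comp_id, Iso.inv_hom_id_assoc]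

/-- A morphism between affine schemes inducing an isomorphism on global sections is an
isomorphism. [folklore] -/
theorem isIso_of_isIso_appTop {X Z : Scheme.{u}} [IsAffine X] [IsAffine Z] (f : X ⟶ Z)
    [IsIso f.appTop] : IsIso f := by
  have e : f = X.isoSpec.hom ≫ Spec.map f.appTop ≫ Z.isoSpec.inv := by
    rw [← Category.assoc, Scheme.isoSpec, asIso_hom, ← Scheme.toSpecΓ_naturality, Category.assoc,
      Scheme.isoSpec, asIso_inv, IsIso.hom_inv_id, Category.comp_id]
  rw [e]
  infer_instance

/-- If `f|_O` is an isomorphism then so is `f♯ : Γ(Y, V) → Γ(X, f⁻¹V)` for every open `V ⊆ O`.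
[folklore] -/
theorem isIso_app_of_isIso_morphismRestrict_of_le {X Y : Scheme.{u}} (f : X ⟶ Y) (O : Y.Opens)
    [IsIso (f ∣_ O)] (V : Y.Opens) (hV : V ≤ O) : IsIso (f.app V) := by
  have e : O.ι ''ᵁ (O.ι ⁻¹ᵁ V) = V := by
    rw [Scheme.Hom.image_preimage_eq_opensRange_inf, Scheme.Opens.opensRange_ι, inf_eq_right.mpr hV]
  have h : IsIso (f.app (O.ι ''ᵁ (O.ι ⁻¹ᵁ V))) := by
    have h2 := morphismRestrict_app f O (O.ι ⁻¹ᵁ V)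
    haveI : IsIso (f.app (O.ι ''ᵁ (O.ι ⁻¹ᵁ V)) ≫
        X.presheaf.map (eqToHom (image_morphismRestrict_preimage f O (O.ι ⁻¹ᵁ V))).op) := by
      rw [← h2]; infer_instance
    exact IsIso.of_isIso_comp_right (f.app (O.ι ''ᵁ (O.ι ⁻¹ᵁ V)))
      (X.presheaf.map (eqToHom (image_morphismRestrict_preimage f O (O.ι ⁻¹ᵁ V))).op)
  rwa [e] at h

/-- If `f♯ : Γ(Y, U) → Γ(X, f⁻¹U)` is an isomorphism then so is `(f|_U)♯` on global sections.
[folklore] -/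
theorem isIso_appTop_morphismRestrict {X Y : Scheme.{u}} (f : X ⟶ Y) (U : Y.Opens)
    [IsIso (f.app U)] : IsIso (f ∣_ U).appTop := by
  rw [morphismRestrict_appTop]
  have h : IsIso (f.app (U.ι ''ᵁ ⊤)) := by rw [Scheme.Opens.ι_image_top]; infer_instance
  infer_instance

end Generic


/-! ## The chart lemma: algebra -/

section ChartAlgebra

variable {Z S : Scheme.{u}} (ζ : Z ⟶ S) (C : S.affineOpens)
  (hζC : (⊤ : Z.Opens) ≤ ζ ⁻¹ᵁ (C : S.Opens)) (u : Γ(S, C))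

/-- The preimage of `D(u)` is the basic open of the pulled-back section. [folklore] -/
theorem preimage_basicOpen_eq_basicOpen_appLE :
    ζ ⁻¹ᵁ S.basicOpen u = Z.basicOpen (ζ.appLE C ⊤ hζC u) := by
  rw [Scheme.basicOpen_appLE, top_inf_eq]

/-- **Relations for a section of `Z` over `D(u)`.** If `ζ` is an isomorphism over `D(u)` and
`ζ⁻¹D(u)` is quasi-compact and schematically dense in `Z`, every global section `b` of `Z`
satisfies `u^n · b = g` for some `n` and some section `g` of `S` over `C` (pulled back to `Z`):
over `D(u)`, `b` is a fraction `g / uⁿ`. [folklore] -/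
theorem exists_pow_mul_eq_appLE [IsIso (ζ ∣_ S.basicOpen u)]
    [QuasiCompact (ζ ⁻¹ᵁ S.basicOpen u).ι] [IsSchemeTheoreticallyDominant (ζ ⁻¹ᵁ S.basicOpen u).ι]
    (b : Γ(Z, ⊤)) :
    ∃ (n : ℕ) (g : Γ(S, C)), ζ.appLE C ⊤ hζC u ^ n * b = ζ.appLE C ⊤ hζC g := by
  set D := S.basicOpen u with hD
  haveI := C.2.isLocalization_basicOpen u
  haveI := isIso_app_of_isIso_morphismRestrict ζ D
  -- restriction `Γ(Z, ⊤) → Γ(Z, ζ⁻¹D)` is injective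
  have hinj : Function.Injective (Z.presheaf.map (homOfLE (le_top : ζ ⁻¹ᵁ D ≤ ⊤)).op) :=
    map_injective_of_isSchemeTheoreticallyDominant_of_le (ζ ⁻¹ᵁ D) le_top (by simp)
  -- `b|_{ζ⁻¹D}` comes from `Γ(S, D) = Γ(S, C)[1/u]`
  set x : Γ(S, D) := inv (ζ.app D) (Z.presheaf.map (homOfLE (le_top : ζ ⁻¹ᵁ D ≤ ⊤)).op b) with hx
  obtain ⟨⟨g, ⟨_, n, rfl⟩⟩, hgx⟩ := IsLocalization.surj (Submonoid.powers u) x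
  refine ⟨n, g, hinj ?_⟩
  -- compare after restriction to `ζ⁻¹D`, through `Γ(S, D) ≅ Γ(Z, ζ⁻¹D)`
  have happ : ∀ a : Γ(S, C), Z.presheaf.map (homOfLE (le_top : ζ ⁻¹ᵁ D ≤ ⊤)).op
      (ζ.appLE C ⊤ hζC a) = ζ.app D (algebraMap Γ(S, C) Γ(S, D) a) := by
    intro a
    have hDC : ζ ⁻¹ᵁ D ≤ ζ ⁻¹ᵁ (C : S.Opens) := fun x hx => S.basicOpen_le u hx
    have hl : ζ.appLE C ⊤ hζC ≫ Z.presheaf.map (homOfLE (le_top : ζ ⁻¹ᵁ D ≤ ⊤)).op =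
        ζ.appLE C (ζ ⁻¹ᵁ D) hDC := Scheme.Hom.appLE_map _ _ _
    have hr : S.presheaf.map (homOfLE (S.basicOpen_le u)).op ≫ ζ.app D =
        ζ.appLE C (ζ ⁻¹ᵁ D) hDC := by
      rw [Scheme.Hom.app_eq_appLE, Scheme.Hom.map_appLE]
    change (ζ.appLE C ⊤ hζC ≫ Z.presheaf.map (homOfLE (le_top : ζ ⁻¹ᵁ D ≤ ⊤)).op) a =
      (S.presheaf.map (homOfLE (S.basicOpen_le u)).op ≫ ζ.app D) a
    rw [hl, hr]
  have hxb : ζ.app D x = Z.presheaf.map (homOfLE (le_top : ζ ⁻¹ᵁ D ≤ ⊤)).op b := by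
    rw [hx, ← CommRingCat.comp_apply, IsIso.inv_hom_id, CommRingCat.id_apply]
  dsimp only at hgx
  rw [map_pow] at hgx
  rw [map_mul, map_pow, happ, happ, ← hxb, ← map_pow, ← map_mul, mul_comm, hgx]

/-- **Generators and relations.** For `ζ` locally of finite type, an isomorphism over `D(u)` with
`ζ⁻¹D(u)` quasi-compact and schematically dense: `Γ(Z, 𝒪_Z)` is generated over `Γ(S, C)` by
finitely many sections `b` with `u^N b = g_b` (`N ≥ 1`). [folklore] -/
theorem exists_finset_generators_relations [LocallyOfFiniteType ζ] [IsIso (ζ ∣_ S.basicOpen u)]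
    [QuasiCompact (ζ ⁻¹ᵁ S.basicOpen u).ι] [IsSchemeTheoreticallyDominant (ζ ⁻¹ᵁ S.basicOpen u).ι]
    [IsAffine Z] :
    ∃ (s : Finset Γ(Z, ⊤)) (N : ℕ) (g : Γ(Z, ⊤) → Γ(S, C)),
      Subring.closure (Set.range (ζ.appLE C ⊤ hζC) ∪ ↑s) = ⊤ ∧ 0 < N ∧
      ∀ b ∈ s, ζ.appLE C ⊤ hζC u ^ N * b = ζ.appLE C ⊤ hζC (g b) := by
  classical
  have hft : (ζ.appLE C ⊤ hζC).hom.FiniteType :=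
    HasRingHomProperty.appLE @LocallyOfFiniteType ζ ‹_› C ⟨⊤, isAffineOpen_top Z⟩ hζC
  letI := (ζ.appLE (C : S.Opens) ⊤ hζC).hom.toAlgebra
  have hFT : Algebra.FiniteType Γ(S, C) Γ(Z, ⊤) := hft
  obtain ⟨s, hs⟩ := hFT.out
  choose n g hng using fun b : Γ(Z, ⊤) => exists_pow_mul_eq_appLE ζ C hζC u b
  refine ⟨s, s.sup n + 1, fun b => g b * u ^ (s.sup n + 1 - n b), ?_, Nat.succ_pos _, fun b hb => ?_⟩
  · rw [eq_top_iff]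
    intro x _
    have hx : x ∈ Algebra.adjoin Γ(S, C) (s : Set Γ(Z, ⊤)) := hs ▸ Algebra.mem_top
    exact Algebra.mem_adjoin_iff.mp hx
  · have hle : n b ≤ s.sup n + 1 := (Finset.le_sup hb).trans (Nat.le_succ _)
    calc ζ.appLE C ⊤ hζC u ^ (s.sup n + 1) * b
        = ζ.appLE C ⊤ hζC u ^ (s.sup n + 1 - n b) * (ζ.appLE C ⊤ hζC u ^ n b * b) := by
          rw [← mul_assoc, ← pow_add, Nat.sub_add_cancel hle]
      _ = ζ.appLE C ⊤ hζC (g b * u ^ (s.sup n + 1 - n b)) := by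
          rw [hng, map_mul, map_pow, mul_comm]

end ChartAlgebra

/-! ## The chart lemma: a section of the strict transform over a good affine open -/

section ChartSection

variable {Z S T : Scheme.{u}} (ζ : Z ⟶ S) (u : Γ(S, ⊤)) (b : T ⟶ S)

/-- Naturality: restricting `ζ♯(a)` to `ζ⁻¹D(u)` gives `ζ♯_{D(u)}(a|_{D(u)})`. [folklore] -/
theorem map_appTop_eq_app_basicOpen (a : Γ(S, ⊤)) :
    Z.presheaf.map (homOfLE (le_top : ζ ⁻¹ᵁ S.basicOpen u ≤ ⊤)).op (ζ.appTop a) =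
      ζ.app (S.basicOpen u) (S.presheaf.map (homOfLE (S.basicOpen_le u)).op a) := by
  change (ζ.appTop ≫ Z.presheaf.map _) a = (S.presheaf.map _ ≫ ζ.app _) a
  congr 1
  rw [Scheme.Hom.appTop, Scheme.Hom.app_eq_appLE, Scheme.Hom.appLE_map, Scheme.Hom.app_eq_appLE,
    Scheme.Hom.map_appLE]

variable [IsIso (ζ ∣_ S.basicOpen u)]

/-- **The transfer map** `θ₀ : Γ(Z, 𝒪_Z) → Γ(T, b⁻¹D(u))`: restrict to `ζ⁻¹D(u) ≅ D(u)` and pull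
back along `b`. On sections coming from `S` it is the pull-back along `b`. [folklore] -/
theorem transfer_appTop (a : Γ(S, ⊤)) :
    haveI := isIso_app_of_isIso_morphismRestrict ζ (S.basicOpen u)
    b.app (S.basicOpen u) (inv (ζ.app (S.basicOpen u))
      (Z.presheaf.map (homOfLE (le_top : ζ ⁻¹ᵁ S.basicOpen u ≤ ⊤)).op (ζ.appTop a))) =
      b.appLE ⊤ (b ⁻¹ᵁ S.basicOpen u) le_top a := by
  haveI := isIso_app_of_isIso_morphismRestrict ζ (S.basicOpen u)
  rw [map_appTop_eq_app_basicOpen, IsIso.hom_inv_id_apply]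
  change (S.presheaf.map _ ≫ b.app _) a = _
  rw [Scheme.Hom.app_eq_appLE, Scheme.Hom.map_appLE]

omit [IsIso (ζ ∣_ S.basicOpen u)] in
/-- A section `s ∈ Γ(X, U)` with `U ⊆ D(s)` is a unit. [folklore] -/
theorem isUnit_of_le_basicOpen {X : Scheme.{u}} {U : X.Opens} (s : Γ(X, U))
    (h : U ≤ X.basicOpen s) : IsUnit s :=
  RingedSpace.isUnit_of_isUnit_germ (X := X.toRingedSpace) _ _ fun x hx =>
    (X.mem_basicOpen _ x hx).mp (h hx)

/-- **The ring map of the section over a good open.** With `θ₀` the transfer map, `W ⊆ T` an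
open and `c_x ∈ Γ(T, W)` with `b♯(g_x) = c_x · b♯(u)^N` on `W` for the generators `x ∈ s`
(`u^N x = g_x` in `Γ(Z, 𝒪_Z)`): there is a ring map `χ : Γ(Z, 𝒪_Z) → Γ(T, W)` over `Γ(S, 𝒪_S)`
with `χ(x) = c_x` — namely `θ₀` followed by restriction to `W ∩ b⁻¹D(u)`, which takes values in
the subring `Γ(T, W) ⊆ Γ(T, W ∩ b⁻¹D(u))` (`b⁻¹D(u)` being schematically dense). [folklore] -/
theorem exists_ringHom_section (s : Finset Γ(Z, ⊤)) (N : ℕ) (g : Γ(Z, ⊤) → Γ(S, ⊤))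
    (hrel : ∀ x ∈ s, ζ.appTop u ^ N * x = ζ.appTop (g x))
    (hgen : Subring.closure (Set.range ζ.appTop ∪ ↑s) = ⊤)
    (L : S.IdealSheafData) (hL : centreCompl L = S.basicOpen u)
    (hLb : IsEffectiveCartier (L.comap b)) (W : T.Opens) (c : Γ(Z, ⊤) → Γ(T, W))
    (hc : ∀ x ∈ s, b.appLE ⊤ W le_top (g x) = c x * b.appLE ⊤ W le_top u ^ N) :
    ∃ χ : Γ(Z, ⊤) →+* Γ(T, W),
      (∀ a, χ (ζ.appTop a) = b.appLE ⊤ W le_top a) ∧ (∀ x ∈ s, χ x = c x) := by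
  haveI := isIso_app_of_isIso_morphismRestrict ζ (S.basicOpen u)
  set D := S.basicOpen u with hD
  -- the dense open `O = b⁻¹D`
  set O : T.Opens := centreCompl (L.comap b) with hO
  have hOD : O = b ⁻¹ᵁ D := by rw [hO, ← preimage_centreCompl, hL]
  haveI : QuasiCompact O.ι := hLb.quasiCompact_ι_centreCompl
  haveI : IsSchemeTheoreticallyDominant O.ι := hLb.isSchemeTheoreticallyDominant_ι_centreCompl
  have hWO : W ⊓ O ≤ b ⁻¹ᵁ D := fun x hx => hOD.le hx.2
  -- `ι : Γ(T, W) ↪ Γ(T, W ∩ O)` and `θ : Γ(Z, ⊤) → Γ(T, W ∩ O)`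
  set ι : Γ(T, W) →+* Γ(T, W ⊓ O) := (T.presheaf.map (homOfLE (inf_le_left : W ⊓ O ≤ W)).op).hom
    with hι
  have hιinj : Function.Injective ι := map_injective_of_isSchemeTheoreticallyDominant O W
  set θ : Γ(Z, ⊤) →+* Γ(T, W ⊓ O) :=
    (T.presheaf.map (homOfLE hWO).op).hom.comp ((b.app D).hom.comp ((inv (ζ.app D)).hom.comp
      (Z.presheaf.map (homOfLE (le_top : ζ ⁻¹ᵁ D ≤ ⊤)).op).hom)) with hθ
  -- on sections from `S`, both are the pull-back along `b`
  have hA : ∀ a, θ (ζ.appTop a) = ι (b.appLE ⊤ W le_top a) := fun a => by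
    have h1 : θ (ζ.appTop a) = T.presheaf.map (homOfLE hWO).op (b.appLE ⊤ (b ⁻¹ᵁ D) le_top a) := by
      simp only [hθ, RingHom.comp_apply]
      rw [← transfer_appTop ζ u b a]
    rw [h1]
    change (b.appLE ⊤ (b ⁻¹ᵁ D) le_top ≫ T.presheaf.map (homOfLE hWO).op) a =
      (b.appLE ⊤ W le_top ≫ T.presheaf.map (homOfLE _).op) a
    rw [Scheme.Hom.appLE_map, Scheme.Hom.appLE_map]
  -- `b♯u` is a unit on `W ∩ O`
  have hunit : IsUnit (θ (ζ.appTop u)) := by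
    rw [hA]
    refine isUnit_of_le_basicOpen _ fun x hx => ?_
    change x ∈ T.basicOpen ((b.appLE ⊤ W le_top ≫ T.presheaf.map (homOfLE _).op) u)
    rw [Scheme.Hom.appLE_map, Scheme.basicOpen_appLE]
    exact ⟨hx, hWO hx⟩
  -- on the generators, `θ x = ι (c x)`
  have hB : ∀ x ∈ s, θ x = ι (c x) := fun x hx => by
    have h1 : θ (ζ.appTop u) ^ N * θ x = ι (c x) * θ (ζ.appTop u) ^ N := by
      rw [← map_pow, ← map_mul, hrel x hx, hA, hc x hx, map_mul, map_pow, ← hA, map_pow]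
    rw [mul_comm (ι (c x))] at h1
    exact (hunit.pow N).mul_right_injective h1
  -- hence `θ` takes values in `Γ(T, W)`
  have hrange : ∀ y, θ y ∈ Set.range ι := by
    have hle : Subring.closure (Set.range ζ.appTop ∪ ↑s) ≤ ι.range.comap θ := by
      rw [Subring.closure_le]
      rintro y (⟨a, rfl⟩ | hy)
      · exact ⟨_, (hA a).symm⟩
      · exact ⟨_, (hB y hy).symm⟩
    intro y
    have : y ∈ ι.range.comap θ := hle (hgen ▸ Subring.mem_top y)
    exact this
  obtain ⟨χ, hχ⟩ := RingHom.exists_comp_eq_of_forall_mem_range θ ι hιinj hrange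
  refine ⟨χ, fun a => hιinj ?_, fun x hx => hιinj ?_⟩
  · rw [← hA, ← hχ]; rfl
  · rw [← hB x hx, ← hχ]; rfl

omit [IsIso (ζ ∣_ S.basicOpen u)] in
/-- **The morphism of the section.** A ring map `χ : Γ(Z, 𝒪_Z) → Γ(T, W)` over `Γ(S, 𝒪_S)`, for
`Z` and `S` affine, is `w♯` for a morphism `w : W → Z` over `S`. [folklore] -/
theorem exists_hom_over_of_ringHom [IsAffine Z] [IsAffine S] (W : T.Opens)
    (χ : Γ(Z, ⊤) →+* Γ(T, W)) (hχ : ∀ a, χ (ζ.appTop a) = b.appLE ⊤ W le_top a) :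
    ∃ w : (W : Scheme.{u}) ⟶ Z, w.appTop = CommRingCat.ofHom χ ≫ W.topIso.inv ∧
      w ≫ ζ = W.ι ≫ b := by
  obtain ⟨w, hw⟩ := exists_hom_appTop_eq (CommRingCat.ofHom χ ≫ W.topIso.inv)
  refine ⟨w, hw, ext_of_isAffine ?_⟩
  rw [Scheme.Hom.comp_appTop, Scheme.Hom.comp_appTop, hw]
  ext a
  change W.topIso.inv (χ (ζ.appTop a)) = W.ι.appTop (b.appTop a)
  rw [hχ, Scheme.Opens.topIso_inv, Scheme.Opens.ι_appTop]
  change (b.appLE ⊤ W le_top ≫ T.presheaf.map _) a = (b.appTop ≫ T.presheaf.map _) a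
  rw [Scheme.Hom.appLE_map, Scheme.Hom.appTop, Scheme.Hom.app_eq_appLE, Scheme.Hom.appLE_map]

omit [IsIso (ζ ∣_ S.basicOpen u)] in
/-- **The section of the strict transform over a good open.** A morphism `w : W → Z` over `S`
(`W ⊆ T` open) lifts to the strict transform `Z'` of `Z` along `b` (with respect to `U = S ∖ V(L)`,
`b⁻¹L 𝒪_T` an effective Cartier divisor): the graph `(w, ι) : W → Z ×_S T` kills the ideal of
`Z'`, the closure of the part over `b⁻¹U`, because `W ∩ b⁻¹U` is schematically dense in `W`.
[folklore] -/
theorem exists_lift_strictTransform (L : S.IdealSheafData) (hLb : IsEffectiveCartier (L.comap b))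
    (W : T.Opens) (w : (W : Scheme.{u}) ⟶ Z) (hw : w ≫ ζ = W.ι ≫ b) :
    ∃ σ : (W : Scheme.{u}) ⟶ blowupStrictTransform ζ b L,
      σ ≫ blowupStrictTransformι ζ b L = pullback.lift w W.ι hw := by
  set e := pullback.lift w W.ι hw with he
  set O' : (pullback ζ b).Opens := (pullback.snd ζ b) ⁻¹ᵁ (b ⁻¹ᵁ centreCompl L) with hO'
  haveI : QuasiCompact O'.ι := by
    rw [hO', preimage_centreCompl]
    exact quasiCompact_ι_preimage_centreCompl _ hLb
  have heO : e ⁻¹ᵁ O' = W.ι ⁻¹ᵁ (centreCompl (L.comap b)) := by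
    rw [hO', ← preimage_centreCompl, ← Scheme.Hom.comp_preimage, he, pullback.lift_snd]
  haveI : QuasiCompact (centreCompl (L.comap b)).ι := hLb.quasiCompact_ι_centreCompl
  haveI : IsSchemeTheoreticallyDominant (centreCompl (L.comap b)).ι :=
    hLb.isSchemeTheoreticallyDominant_ι_centreCompl
  haveI : QuasiCompact (e ⁻¹ᵁ O').ι := by
    rw [heO]; exact quasiCompact_ι_preimage W.ι _
  haveI : IsSchemeTheoreticallyDominant (e ⁻¹ᵁ O').ι := by
    rw [heO]; exact isSchemeTheoreticallyDominant_ι_preimage W.ι _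
  have hker : (blowupStrictTransformι ζ b L).ker ≤ e.ker := by
    rw [ker_blowupStrictTransformι]
    exact ker_ι_le_ker e O'
  exact ⟨IsClosedImmersion.lift _ e hker, IsClosedImmersion.lift_fac _ e hker⟩

/-- **The strict transform is an isomorphism over a good open.** Let `Z → S` be a morphism of
affine schemes which is an isomorphism over `D(u)`, `Γ(Z, 𝒪_Z)` generated over `Γ(S, 𝒪_S)` by
finitely many `x` with `u^N x = g_x`; let `b : T → S` with `b⁻¹L 𝒪_T` an effective Cartier
divisor, `S ∖ V(L) = D(u)`, and `W ⊆ T` an open carrying sections `c_x` with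
`b♯(g_x) = c_x · b♯(u)^N`. Then the strict transform `Z' → T` of `Z` along `b` is an isomorphism
over `W`: the section `σ : W → Z'` (`exists_lift_strictTransform` applied to the morphism of
`exists_ringHom_section`/`exists_hom_over_of_ringHom`) is inverse to `Z'|_W → W`, the two
composites being compared inside `Z ×_S T` — over `T` trivially, over the affine `Z` through
global sections, where they agree on `Γ(S, 𝒪_S)` and on the generators `x` because `b♯(u)` is a
non-zero-divisor on the strict transform. [cite: Conrad2007, proof of Thm. 2.4, Case 1] -/
theorem isIso_morphismRestrict_blowupStrictTransformMap_of_sections [IsAffine Z] [IsAffine S]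
    (s : Finset Γ(Z, ⊤)) (N : ℕ) (g : Γ(Z, ⊤) → Γ(S, ⊤))
    (hrel : ∀ x ∈ s, ζ.appTop u ^ N * x = ζ.appTop (g x))
    (hgen : Subring.closure (Set.range ζ.appTop ∪ ↑s) = ⊤)
    (L : S.IdealSheafData) (hL : centreCompl L = S.basicOpen u)
    (hLb : IsEffectiveCartier (L.comap b)) (W : T.Opens) (c : Γ(Z, ⊤) → Γ(T, W))
    (hc : ∀ x ∈ s, b.appLE ⊤ W le_top (g x) = c x * b.appLE ⊤ W le_top u ^ N) :
    IsIso ((blowupStrictTransformMap ζ b L) ∣_ W) := by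
  obtain ⟨χ, hχa, hχs⟩ := exists_ringHom_section ζ u b s N g hrel hgen L hL hLb W c hc
  obtain ⟨w, hwapp, hw⟩ := exists_hom_over_of_ringHom ζ b W χ hχa
  obtain ⟨σ, hσ⟩ := exists_lift_strictTransform ζ b L hLb W w hw
  set q := blowupStrictTransformMap ζ b L with hq
  set stι := blowupStrictTransformι ζ b L with hstι
  have hσq : σ ≫ q = W.ι := by
    rw [hq, ← blowupStrictTransformι_snd, ← Category.assoc, hσ, pullback.lift_snd]
  set Q : (blowupStrictTransform ζ b L).Opens := q ⁻¹ᵁ W with hQ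
  have hrange : Set.range σ ⊆ Set.range Q.ι := by
    rintro _ ⟨x, rfl⟩
    rw [Scheme.Opens.range_ι]
    change q (σ x) ∈ W
    rw [← Scheme.Hom.comp_apply, hσq]
    exact x.2
  set σ' := IsOpenImmersion.lift Q.ι σ hrange with hσ'
  have hσ'ι : σ' ≫ Q.ι = σ := IsOpenImmersion.lift_fac _ _ _
  -- `σ'` is a right inverse
  have h1 : σ' ≫ (q ∣_ W) = 𝟙 _ := by
    rw [← cancel_mono W.ι, Category.assoc, morphismRestrict_ι, ← Category.assoc, hσ'ι, hσq,
      Category.id_comp]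
  -- and a left inverse: compare inside `Z ×_S T`
  have h2 : (q ∣_ W) ≫ σ' = 𝟙 _ := by
    rw [← cancel_mono (Q.ι ≫ stι)]
    simp only [Category.assoc, Category.id_comp]
    rw [reassoc_of% hσ'ι, hσ]
    apply pullback.hom_ext
    · -- over `Z`: through global sections of the affine `Z`
      rw [Category.assoc, pullback.lift_fst, Category.assoc]
      -- the two morphisms `Q → Z` agree after `ζ` (both are `Q → T → S`)
      have hR : (Q.ι ≫ stι ≫ pullback.fst ζ b) ≫ ζ = Q.ι ≫ q ≫ b := by
        simp only [Category.assoc, pullback.condition]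
        rw [hq, hstι, ← blowupStrictTransformι_snd, Category.assoc]
      have hζeq : ((q ∣_ W) ≫ w) ≫ ζ = (Q.ι ≫ stι ≫ pullback.fst ζ b) ≫ ζ := by
        rw [hR, Category.assoc, hw, ← Category.assoc, morphismRestrict_ι, Category.assoc]
      apply ext_of_isAffine
      set γ := ((q ∣_ W) ≫ w).appTop with hγdef
      set β := (Q.ι ≫ stι ≫ pullback.fst ζ b).appTop with hβdef
      have hγ : ∀ y, γ y = (q ∣_ W).appTop (W.topIso.inv (χ y)) := fun y => by
        rw [hγdef, Scheme.Hom.comp_appTop, hwapp]; rfl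
      have hβγ : ∀ a, β (ζ.appTop a) = γ (ζ.appTop a) := fun a => by
        rw [hβdef, hγdef, ← CommRingCat.comp_apply, ← Scheme.Hom.comp_appTop, ← hζeq,
          Scheme.Hom.comp_appTop, CommRingCat.comp_apply]
      -- `υ = b♯u` on `Q` is a non-zero-divisor: it is a unit on the dense open over `b⁻¹D(u)`
      set υ := β (ζ.appTop u) with hυdef
      have hυ : υ ∈ nonZeroDivisors Γ(Q, ⊤) := by
        obtain ⟨hqc, hsd⟩ := quasiCompact_and_isSchemeTheoreticallyDominant_ι_preimage ζ b L hLb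
        haveI := hqc
        haveI := hsd
        haveI := quasiCompact_ι_preimage Q.ι (q ⁻¹ᵁ (b ⁻¹ᵁ centreCompl L))
        haveI := isSchemeTheoreticallyDominant_ι_preimage Q.ι (q ⁻¹ᵁ (b ⁻¹ᵁ centreCompl L))
        refine mem_nonZeroDivisors_of_inf_le_basicOpen (Q.ι ⁻¹ᵁ (q ⁻¹ᵁ (b ⁻¹ᵁ centreCompl L))) ⊤ υ
          fun x hx => ?_
        have hυ' : υ = (Q.ι ≫ q ≫ b).appTop u := by
          rw [hυdef, hβdef, ← CommRingCat.comp_apply, ← Scheme.Hom.comp_appTop, hR]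
        rw [hυ', ← Scheme.preimage_basicOpen_top, ← hL, Scheme.Hom.comp_preimage,
          Scheme.Hom.comp_preimage]
        exact hx.2
      -- on the generators: `υ^N β(x) = β(g_x) = γ(g_x) = γ(c_x) υ^N = γ(x) υ^N`
      have hgenEq : ∀ x ∈ s, β x = γ x := fun x hx => by
        have key : υ ^ N * β x = υ ^ N * γ x := by
          calc υ ^ N * β x = β (ζ.appTop u ^ N * x) := by rw [map_mul, map_pow]
            _ = γ (ζ.appTop (g x)) := by rw [hrel x hx, hβγ]
            _ = (q ∣_ W).appTop (W.topIso.inv (c x * b.appLE ⊤ W le_top u ^ N)) := by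
                rw [hγ, hχa, hc x hx]
            _ = γ x * γ (ζ.appTop u) ^ N := by
                rw [map_mul, map_pow, map_mul, map_pow, hγ x, hχs x hx, hγ, hχa]
            _ = υ ^ N * γ x := by rw [← hβγ, mul_comm]
        have h0 : (β x - γ x) * υ ^ N = 0 := by rw [sub_mul, mul_comm, key, mul_comm, sub_self]
        exact sub_eq_zero.mp ((mem_nonZeroDivisors_iff_right.mp (pow_mem hυ N)) _ h0)
      apply CommRingCat.hom_ext
      refine RingHom.eq_of_eqOn_set_dense hgen ?_
      rintro y (⟨a, rfl⟩ | hy)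
      · exact (hβγ a).symm
      · exact (hgenEq y hy).symm
    · rw [Category.assoc, pullback.lift_snd, Category.assoc, hstι, blowupStrictTransformι_snd,
        ← hq, morphismRestrict_ι]
  exact ⟨⟨σ', h2, h1⟩⟩

end ChartSection
/-! ## The chart lemma: every point of the strict transform lies over a good affine open -/

section ChartExclusion

variable {Z S T : Scheme.{u}} [IsAffine S] (ζ : Z ⟶ S) (u : Γ(S, ⊤)) (b : T ⟶ S)

/-- **Exclusion.** In the situation of the chart lemma, with `J = (u^N, g_x : x ∈ s) ⊆ Γ(S, 𝒪_S)`
and `b⁻¹J 𝒪_T` an effective Cartier divisor, every point of the strict transform `Z'` of `Z`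
along `b` lies over an affine open `W ⊆ T` on which `b♯(u)^N` divides every `b♯(g_x)`.
Indeed, near `t = q(z)` write `b⁻¹J 𝒪_T(W) = (τ)` with `τ` regular, `b♯u^N = v₀ τ`,
`b♯g_x = v_x τ`, `1 = w₀ v₀ + Σ w_x v_x`; if `v_x(t) ≠ 0` then over `D(v_x)` the relation
`u^N x = g_x` on `Z'` reads `μ^N π(x) = ρ(g_x)` with `μ = b♯u` regular on `Z'` (a unit on the
dense open over `b⁻¹D(u)`), whence `1 = ρ(v₀) · (…)` near `z` and `v₀(t) ≠ 0` anyway.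
[cite: Conrad2007, proof of Thm. 2.4, Case 1] -/
theorem exists_affineOpen_sections (s : Finset Γ(Z, ⊤)) (N : ℕ) (g : Γ(Z, ⊤) → Γ(S, ⊤))
    (hrel : ∀ x ∈ s, ζ.appTop u ^ N * x = ζ.appTop (g x))
    (L : S.IdealSheafData) (hL : centreCompl L = S.basicOpen u)
    (hLb : IsEffectiveCartier (L.comap b))
    (hGb : IsEffectiveCartier ((Scheme.IdealSheafData.ofIdealTop
      (Ideal.span (insert (u ^ N) (g '' (s : Set Γ(Z, ⊤)))))).comap b))
    (z : blowupStrictTransform ζ b L) :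
    ∃ (W : T.affineOpens) (c : Γ(Z, ⊤) → Γ(T, W)),
      blowupStrictTransformMap ζ b L z ∈ (W : T.Opens) ∧
      ∀ x ∈ s, b.appLE ⊤ W le_top (g x) = c x * b.appLE ⊤ W le_top u ^ N := by
  classical
  set q := blowupStrictTransformMap ζ b L with hq
  set stι := blowupStrictTransformι ζ b L with hstι
  set G := Scheme.IdealSheafData.ofIdealTop
    (Ideal.span (insert (u ^ N) (g '' (s : Set Γ(Z, ⊤))))) with hG
  set t := q z with ht
  obtain ⟨W, htW, τ, hτ, hGW⟩ := hGb t
  -- the generators of `b⁻¹J 𝒪_T(W)`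
  set gens : Finset Γ(S, ⊤) := insert (u ^ N) (s.image g) with hgens
  set t' : Finset Γ(T, W) := gens.image (b.appLE ⊤ W le_top) with ht'
  have hgens' : (insert (u ^ N) (g '' (s : Set Γ(Z, ⊤)))) = (↑gens : Set Γ(S, ⊤)) := by
    rw [hgens, Finset.coe_insert, Finset.coe_image]
  have hGW' : (G.comap b).ideal W = Ideal.span (↑t' : Set Γ(T, W)) := by
    rw [ideal_comap_of_le b G ⟨⊤, isAffineOpen_top S⟩ W le_top, hG, hgens',
      Scheme.IdealSheafData.ofIdealTop_ideal, Ideal.map_map, Ideal.map_span, ht', Finset.coe_image]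
    congr 2
    ext a
    change (S.presheaf.map _ ≫ b.appLE ⊤ W le_top) a = _
    rw [Scheme.Hom.map_appLE]
  rw [hGW'] at hGW
  -- `τ = Σ f_e e` and `e = v_e τ`
  obtain ⟨f, -, hf⟩ := Submodule.mem_span_finset.mp
    (show τ ∈ Ideal.span (↑t' : Set Γ(T, W)) from hGW ▸ Ideal.mem_span_singleton_self τ)
  have hv : ∀ e ∈ t', ∃ v : Γ(T, W), v * τ = e := fun e he =>
    Ideal.mem_span_singleton'.mp (hGW.symm ▸ Ideal.subset_span he)
  choose! v hv using hv
  have hsum : ∑ e ∈ t', f e * v e = 1 := by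
    have h1 : (∑ e ∈ t', f e * v e) * τ = τ := by
      rw [Finset.sum_mul]
      conv_rhs => rw [← hf]
      refine Finset.sum_congr rfl fun e he => ?_
      rw [mul_assoc, hv e he, smul_eq_mul]
    have h2 : (∑ e ∈ t', f e * v e - 1) * τ = 0 := by rw [sub_mul, one_mul, h1, sub_self]
    exact sub_eq_zero.mp ((mem_nonZeroDivisors_iff_right.mp hτ) _ h2)
  -- notation for the generators on `W`
  have hmemU : b.appLE ⊤ W le_top (u ^ N) ∈ t' :=
    Finset.mem_image_of_mem _ (Finset.mem_insert_self _ _)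
  have hmemg : ∀ x ∈ s, b.appLE ⊤ W le_top (g x) ∈ t' := fun x hx =>
    Finset.mem_image_of_mem _ (Finset.mem_insert_of_mem (Finset.mem_image_of_mem g hx))
  set v₀ := v (b.appLE ⊤ W le_top (u ^ N)) with hv₀
  -- KEY: `t ∈ D(v₀)`
  have key : t ∈ T.basicOpen v₀ := by
    obtain ⟨e, he, hte⟩ := exists_mem_basicOpen_of_sum_mul_eq_one t' f v hsum htW
    rw [ht', Finset.mem_image] at he
    obtain ⟨y, hy, rfl⟩ := he
    rw [hgens, Finset.mem_insert, Finset.mem_image] at hy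
    rcases hy with rfl | ⟨x₀, hx₀, rfl⟩
    · exact hte
    -- the case `t ∈ D(v_e)`, `e = b♯(g x₀)`: argue on the strict transform near `z`
    set e := b.appLE ⊤ W le_top (g x₀) with he_def
    have he : e ∈ t' := hmemg x₀ hx₀
    set W₁ : T.Opens := T.basicOpen (v e) with hW₁
    have hW₁W : W₁ ≤ W := T.basicOpen_le _
    set Q : (blowupStrictTransform ζ b L).Opens := q ⁻¹ᵁ W₁ with hQ
    have hzQ : z ∈ Q := hte
    have hQW : Q ≤ q ⁻¹ᵁ W := fun y hy => hW₁W hy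
    set ρ : Γ(T, W) →+* Γ(blowupStrictTransform ζ b L, Q) := (q.appLE W Q hQW).hom with hρ
    set π : Γ(Z, ⊤) →+* Γ(blowupStrictTransform ζ b L, Q) :=
      ((stι ≫ pullback.fst ζ b).appLE ⊤ Q le_top).hom with hπ
    have hR : (stι ≫ pullback.fst ζ b) ≫ ζ = q ≫ b := by
      rw [Category.assoc, pullback.condition, ← Category.assoc, hstι, blowupStrictTransformι_snd]
    have hπρ : ∀ a, π (ζ.appTop a) = ρ (b.appLE ⊤ W le_top a) := fun a => by
      simp only [hπ, hρ]
      change (ζ.appTop ≫ (stι ≫ pullback.fst ζ b).appLE ⊤ Q le_top) a =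
        (b.appLE ⊤ W le_top ≫ q.appLE W Q hQW) a
      rw [Scheme.Hom.appLE_comp_appLE, Scheme.Hom.appTop, Scheme.Hom.app_eq_appLE]
      change (ζ.appLE ⊤ (ζ ⁻¹ᵁ ⊤) le_rfl ≫ (stι ≫ pullback.fst ζ b).appLE (ζ ⁻¹ᵁ ⊤) Q le_top) a = _
      rw [Scheme.Hom.appLE_comp_appLE]
      exact congrArg (fun k : blowupStrictTransform ζ b L ⟶ S => k.appLE ⊤ Q le_top a) hR
    -- `μ = ρ(b♯u)` is a non-zero-divisor on `Γ(Z', Q)`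
    have hμ : ρ (b.appLE ⊤ W le_top u) ∈ nonZeroDivisors _ := by
      obtain ⟨hqc, hsd⟩ := quasiCompact_and_isSchemeTheoreticallyDominant_ι_preimage ζ b L hLb
      haveI := hqc
      haveI := hsd
      refine mem_nonZeroDivisors_of_inf_le_basicOpen (q ⁻¹ᵁ (b ⁻¹ᵁ centreCompl L)) Q _
        fun y hy => ?_
      rw [hρ]
      change y ∈ (blowupStrictTransform ζ b L).basicOpen (q.appLE W Q hQW (b.appLE ⊤ W le_top u))
      rw [Scheme.basicOpen_appLE, Scheme.basicOpen_appLE, ← hL]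
      exact ⟨hy.1, hQW hy.1, hy.2⟩
    -- the relations on `Γ(Z', Q)`
    have r1 : ρ (b.appLE ⊤ W le_top u) ^ N * π x₀ = ρ e := by
      rw [← hπρ, ← map_pow, ← map_mul, hrel x₀ hx₀, hπρ]
    have r2 : ρ (b.appLE ⊤ W le_top u) ^ N = ρ v₀ * ρ τ := by
      rw [← map_pow, ← map_pow, ← hv _ hmemU, map_mul]
    have r3 : ρ e = ρ (v e) * ρ τ := by rw [← map_mul, hv e he]
    have hunit : IsUnit (ρ (v e)) := by
      refine isUnit_of_le_basicOpen _ fun y hy => ?_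
      rw [hρ]
      change y ∈ (blowupStrictTransform ζ b L).basicOpen (q.appLE W Q hQW (v e))
      rw [Scheme.basicOpen_appLE]
      exact ⟨hy, hy⟩
    obtain ⟨ν, hν⟩ := hunit.exists_left_inv
    have h4 : (1 - ρ v₀ * ν * π x₀) * ρ (b.appLE ⊤ W le_top u) ^ N = 0 := by
      have h3 : ρ τ = ν * ρ e := by rw [r3, ← mul_assoc, hν, one_mul]
      have h5 : ρ (b.appLE ⊤ W le_top u) ^ N =
          ρ v₀ * ν * π x₀ * ρ (b.appLE ⊤ W le_top u) ^ N := by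
        conv_lhs => rw [r2, h3, ← r1]
        ring
      rw [sub_mul, one_mul, ← h5, sub_self]
    have h6 : IsUnit (ρ v₀) := by
      have h7 := sub_eq_zero.mp ((mem_nonZeroDivisors_iff_right.mp (pow_mem hμ N)) _ h4)
      exact IsUnit.of_mul_eq_one (ν * π x₀) (by rw [← mul_assoc]; exact h7.symm)
    have hz : z ∈ (blowupStrictTransform ζ b L).basicOpen (ρ v₀) := by
      rw [Scheme.basicOpen_of_isUnit _ h6]; exact hzQ
    rw [hρ] at hz
    change z ∈ (blowupStrictTransform ζ b L).basicOpen (q.appLE W Q hQW v₀) at hz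
    rw [Scheme.basicOpen_appLE] at hz
    exact hz.2
  -- the good affine open `W' = D(v₀) ⊆ W` and the sections `c_x = v_{g_x} v₀⁻¹`
  set W' : T.Opens := T.basicOpen v₀ with hW'
  have hW'W : W' ≤ W := T.basicOpen_le _
  set res : Γ(T, W) →+* Γ(T, W') := (T.presheaf.map (homOfLE hW'W).op).hom with hres_def
  have hv₀unit : IsUnit (res v₀) := RingedSpace.isUnit_res_basicOpen (X := T.toRingedSpace) v₀
  obtain ⟨ν₀, hν₀⟩ := hv₀unit.exists_left_inv
  have hres : ∀ a, b.appLE ⊤ W' le_top a = res (b.appLE ⊤ W le_top a) := fun a => by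
    change _ = (b.appLE ⊤ W le_top ≫ T.presheaf.map _) a
    rw [Scheme.Hom.appLE_map]
  refine ⟨⟨W', W.2.basicOpen v₀⟩, fun x => res (v (b.appLE ⊤ W le_top (g x))) * ν₀, key,
    fun x hx => ?_⟩
  have hτ' : res τ = ν₀ * res (b.appLE ⊤ W le_top u) ^ N := by
    calc res τ = ν₀ * res v₀ * res τ := by rw [hν₀, one_mul]
      _ = ν₀ * res (v₀ * τ) := by rw [mul_assoc, map_mul]
      _ = ν₀ * res (b.appLE ⊤ W le_top u) ^ N := by rw [hv _ hmemU, map_pow, map_pow]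
  change b.appLE ⊤ W' le_top (g x) = res (v (b.appLE ⊤ W le_top (g x))) * ν₀ *
    b.appLE ⊤ W' le_top u ^ N
  have hgx := hv _ (hmemg x hx)
  rw [hres, hres]
  conv_lhs => rw [← hgx, map_mul, hτ']
  ring

/-- **The chart lemma.** Let `ζ : Z → S` be a morphism of affine schemes which is an
isomorphism over `D(u)`, with `Γ(Z, 𝒪_Z)` generated over `Γ(S, 𝒪_S)` by finitely many `x ∈ s`
satisfying `u^N x = g_x`, and put `J = (u^N, g_x : x ∈ s)`. Let `b : T → S` be such that
`b⁻¹L 𝒪_T` (`S ∖ V(L) = D(u)`) and `b⁻¹J 𝒪_T` are effective Cartier divisors (e.g. a blowing up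
of `S` dominating the blowing up in `J · L`). Then the strict transform `Z' → T` of `Z` along `b`
is an open immersion (onto the locus where `b♯u^N` generates `b⁻¹J 𝒪_T`).
(cf. Stacks, Tag 0804). [cite: Conrad2007, proof of Thm. 2.4, Case 1] -/
theorem isOpenImmersion_blowupStrictTransformMap_of_relations [IsAffine Z]
    [IsIso (ζ ∣_ S.basicOpen u)] (s : Finset Γ(Z, ⊤)) (N : ℕ) (g : Γ(Z, ⊤) → Γ(S, ⊤))
    (hrel : ∀ x ∈ s, ζ.appTop u ^ N * x = ζ.appTop (g x))
    (hgen : Subring.closure (Set.range ζ.appTop ∪ ↑s) = ⊤)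
    (L : S.IdealSheafData) (hL : centreCompl L = S.basicOpen u)
    (hLb : IsEffectiveCartier (L.comap b))
    (hGb : IsEffectiveCartier ((Scheme.IdealSheafData.ofIdealTop
      (Ideal.span (insert (u ^ N) (g '' (s : Set Γ(Z, ⊤)))))).comap b)) :
    IsOpenImmersion (blowupStrictTransformMap ζ b L) := by
  set q := blowupStrictTransformMap ζ b L with hq
  -- the good affine opens and their union `T°`
  let P : T.affineOpens → Prop := fun W => ∃ c : Γ(Z, ⊤) → Γ(T, W),
    ∀ x ∈ s, b.appLE ⊤ W le_top (g x) = c x * b.appLE ⊤ W le_top u ^ N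
  set T₀ : T.Opens := ⨆ W : {W : T.affineOpens // P W}, ((W : T.affineOpens) : T.Opens) with hT₀
  have hrange : Set.range q ⊆ Set.range T₀.ι := by
    rintro _ ⟨z, rfl⟩
    obtain ⟨W, c, hzW, hc⟩ := exists_affineOpen_sections ζ u b s N g hrel L hL hLb hGb z
    rw [Scheme.Opens.range_ι]
    exact Opens.mem_iSup.mpr ⟨⟨W, c, hc⟩, hzW⟩
  set q₀ := IsOpenImmersion.lift T₀.ι q hrange with hq₀
  have hq₀q : q₀ ≫ T₀.ι = q := IsOpenImmersion.lift_fac _ _ _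
  -- `q₀` is an open immersion, locally on `T°`
  haveI : IsOpenImmersion q₀ := by
    refine IsZariskiLocalAtTarget.of_iSup_eq_top
      (fun W : {W : T.affineOpens // P W} => T₀.ι ⁻¹ᵁ ((W : T.affineOpens) : T.Opens)) ?_ fun W => ?_
    · rw [← Scheme.Hom.preimage_iSup, ← hT₀, Scheme.Opens.ι_preimage_self]
    · obtain ⟨c, hc⟩ := W.2
      haveI : IsIso (q ∣_ ((W : T.affineOpens) : T.Opens)) :=
        isIso_morphismRestrict_blowupStrictTransformMap_of_sections ζ u b s N g hrel hgen L hL hLb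
          _ c hc
      have key : ∀ f : blowupStrictTransform ζ b L ⟶ T, f = q →
          IsOpenImmersion (f ∣_ ((W : T.affineOpens) : T.Opens)) := by
        rintro f rfl; infer_instance
      haveI : IsOpenImmersion ((q₀ ∣_ T₀.ι ⁻¹ᵁ ((W : T.affineOpens) : T.Opens)) ≫
          (T₀.ι ∣_ ((W : T.affineOpens) : T.Opens))) := by
        rw [← morphismRestrict_comp]
        exact key _ hq₀q
      exact IsOpenImmersion.of_comp _ (T₀.ι ∣_ ((W : T.affineOpens) : T.Opens))
  rw [← hq₀q]
  infer_instance

end ChartExclusion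

end Literature.AlgebraicGeometry.Resolution

end
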